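/-
Copyright (c) 2026. All rights reserved.
Released under Apache 2.0 license as described in the file LICENSE.
Authors: abc-iut cell, seat abc-iut-L4-t10 (gen 5; row «JOINT», L4-lead m65/m73/m82: the typed successor
`Cor_4_5_joint` of this seat's `Cor_4_5_full` and its archimedean-model instances — finding F-L4t10g4-1).
-/
import Literature.AnabelianGeometry.AbsoluteAnabelian.AbsTopIII.FrobeniusPictureMLFCor36vJointModel
import Literature.AnabelianGeometry.AbsoluteAnabelian.AbsTopIII.AutHolLogFrobeniusCor45FullModelClosers
import Literature.AnabelianGeometry.AbsoluteAnabelian.ArchimedeanHolFieldFunctorGeometricPSLCor45Full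
import HarnessLib

/-!
# [AbsTopIII] Cor 4.5 with ALL printed clauses AND one telecore: `Cor_4_5_joint` and its archimedean instances

S. Mochizuki, *Topics in Absolute Anabelian Geometry III*, Cor. 4.5 pp.107–109 (kurims manuscript, lit key
`paper:url-5493eb38cbb7`; bib key `MochizukiAbsTopIII2015`); Cor 3.6 (ii)/(iii)/(v) pp.79–80 («literally the
same statement on the archimedean data», p.107).

Seat abc-iut-L4-t10's `Cor_4_5_full Δ τ` (p425471) is the conjunction of the typed items (i)–(v) and the three
compatibility sentences; its telecore clauses are independent existentials (finding F-L4t10g4-1).  With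
abc-iut-w6-d025's `LogFrobeniusData.Cor_3_6_joint` (p468731: ONE core, ONE telecore of the printed shape, ONE
contact structure serving (ii) ∧ (iii)-telecore ∧ (v)-fourth-sentence) the successor statement is:

* `AbsTopIII.Cor_4_5_joint Δ τ := Cor_4_5_full Δ τ ∧ Δ.Cor_3_6_joint τ`;
* ★ `cor_4_5_joint_arch (𝔄) (X₀) (hE)` / `_TM` — at the archimedean models `𝒞^hol_TF`, `𝒞^hol_TM` of EVERY
  interface datum `𝔄`, from exactly `𝕏₀ : EA` and `IsIdRigid EA` (Prop 4.2 (i)) — this seat's `cor_4_5_full_arch`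
  (p459467) and `cor_3_6_joint_arch` (zero binders); `cor_4_5_joint_arch_iff_cor_4_5` — at the archimedean
  model every compatibility sentence AND the joint witness are theorems; `cor_4_5_joint_arch_of_full` /
  `_iff_full` and the ZERO-BINDER instances at genuine data (`G_{ℚ_p}`, carriers `{ℂ, ℂˣ, 𝔻}`, tripod covers,
  `ℂ ∖ F`, punctured tori, once-punctured elliptic curves, compact surface-group bases `ℍ/Γ̄`, genuine compact
  `X` covered by `ℍ` with surface-group `π₁`).  F-L4t10g4-1 is thereby CLOSED at the
  archimedean model column (abstract data: abc-iut-w6-d025 p467669; MLF model: p468731 /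
  `TFModel.cor_3_6_v_all_model`).

HONEST SCOPE: model-level ≠ node-level ≠ reconstruction; nothing here bears on [IUTchIII] Cor. 3.12 or takes a
side; typed ≠ proved.  One `Prop` definition (the typed successor statement), no instance, no named fact.
-/

namespace Literature.AnabelianGeometry.AbsoluteAnabelian

open _root_.CategoryTheory _root_.Quiver

universe u

namespace AbsTopIII

/-- **[AbsTopIII] Cor 4.5 with ALL printed clauses and ONE telecore `𝔗_LH` serving (ii), (iii), (v)**: the
cell's `Cor_4_5_full Δ τ` (items (i)–(v) + the three compatibility sentences) together with the joint
witness `Cor_3_6_joint` (literally the same statement on the archimedean data, p.107).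
[cite: MochizukiAbsTopIII2015, Corollary 4.5 pp.107–109] -/
def Cor_4_5_joint (Δ : LogFrobeniusData.{u}) (τ : Δ.TelecoreData) : Prop :=
  Cor_4_5_full Δ τ ∧ Δ.Cor_3_6_joint τ

variable (𝔄 : AutHolFieldFunctor.{u})

/-- ★ **[AbsTopIII] Cor 4.5 with ALL printed clauses AND one telecore, at the archimedean model
`𝒳 = 𝒞^hol_TF`, from exactly `𝕏₀ : EA` and `IsIdRigid EA` (Prop 4.2 (i))** — closes F-L4t10g4-1 at the
archimedean models. [cite: MochizukiAbsTopIII2015, Corollary 4.5 pp.107–109] -/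
theorem cor_4_5_joint_arch (X₀ : 𝔄.EA) (hE : IsIdRigid 𝔄.EA) :
    Cor_4_5_joint (archLogFrobeniusData 𝔄) (archTelecoreData 𝔄) :=
  ⟨cor_4_5_full_arch 𝔄 X₀ hE, cor_3_6_joint_arch 𝔄⟩

/-- ★ **The same at the archimedean model `𝒳 = 𝒞^hol_TM`.** [cite: MochizukiAbsTopIII2015, Corollary 4.5 pp.107–109] -/
theorem cor_4_5_joint_arch_TM (X₀ : 𝔄.EA) (hE : IsIdRigid 𝔄.EA) :
    Cor_4_5_joint (archLogFrobeniusDataTM 𝔄) (archTelecoreDataTM 𝔄) :=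
  ⟨cor_4_5_full_arch_TM 𝔄 X₀ hE, cor_3_6_joint_arch_TM 𝔄⟩

/-- **`Cor_4_5_joint ↔ Cor_4_5` at the archimedean model**: every compatibility sentence AND the joint witness
are theorems there. [cite: MochizukiAbsTopIII2015, Corollary 4.5 pp.107–109] -/
theorem cor_4_5_joint_arch_iff_cor_4_5 :
    Cor_4_5_joint (archLogFrobeniusData 𝔄) (archTelecoreData 𝔄) ↔
      Cor_4_5 (archLogFrobeniusData 𝔄) (archTelecoreData 𝔄) :=
  ⟨fun h => h.1.1, fun h => ⟨(cor_4_5_full_arch_iff_cor_4_5 𝔄).mpr h, cor_3_6_joint_arch 𝔄⟩⟩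

/-- At the archimedean model `Cor_4_5_joint` is `Cor_4_5_full` (the joint witness is a theorem there, zero
binders): the upgrade used by every instance below. [cite: MochizukiAbsTopIII2015, Corollary 4.5 pp.107–109] -/
theorem cor_4_5_joint_arch_of_full {𝔄 : AutHolFieldFunctor.{u}}
    (h : Cor_4_5_full (archLogFrobeniusData 𝔄) (archTelecoreData 𝔄)) :
    Cor_4_5_joint (archLogFrobeniusData 𝔄) (archTelecoreData 𝔄) :=
  ⟨h, cor_3_6_joint_arch 𝔄⟩

/-- `Cor_4_5_joint ↔ Cor_4_5_full` at the archimedean model. [cite: MochizukiAbsTopIII2015, Corollary 4.5 pp.107–109] -/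
theorem cor_4_5_joint_arch_iff_full (𝔄 : AutHolFieldFunctor.{u}) :
    Cor_4_5_joint (archLogFrobeniusData 𝔄) (archTelecoreData 𝔄) ↔
      Cor_4_5_full (archLogFrobeniusData 𝔄) (archTelecoreData 𝔄) :=
  ⟨fun h => h.1, cor_4_5_joint_arch_of_full⟩

/-! ### Zero-binder instances at genuine data (the gen-4/gen-5 `Cor_4_5_full` list, now joint) -/

/-- **`Cor_4_5_joint` OUTRIGHT at the Galois-category instance `Π := G_{ℚ_p}`.**
[cite: MochizukiAbsTopIII2015, Corollary 4.5 pp.107–109] -/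
theorem cor_4_5_joint_arch_absoluteGaloisGroup_padic (p : ℕ) [Fact p.Prime] :
    Cor_4_5_joint (archLogFrobeniusData (AutHolFieldFunctor.ofGaloisCategory (Field.absoluteGaloisGroup ℚ_[p])))
      (archTelecoreData (AutHolFieldFunctor.ofGaloisCategory (Field.absoluteGaloisGroup ℚ_[p]))) :=
  cor_4_5_joint_arch_of_full (cor_4_5_full_arch_absoluteGaloisGroup_padic p)

end AbsTopIII

namespace HolRS

open Literature.Geometry.Kaehler Literature.Geometry.Kaehler.ComplexTorus
open Literature.IUT.HodgeTheaters (IsOrientableSurfaceGroup)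
open scoped _root_.Manifold _root_.ContDiff UpperHalfPlane MatrixGroups
open _root_.MulAction

/-- **`Cor_4_5_joint` OUTRIGHT over the geometric carriers `{ℂ, ℂˣ, 𝔻}`.**
[cite: MochizukiAbsTopIII2015, Corollary 4.5 pp.107–109] -/
theorem cor_4_5_joint_geometric_carriers :
    AbsTopIII.Cor_4_5_joint
      (archLogFrobeniusData (geometricAutHolFieldFunctor
        (fun X : HolRS => X = complexPlane ∨ X = puncturedPlane ∨ X = disc)))
      (archTelecoreData (geometricAutHolFieldFunctor
        (fun X : HolRS => X = complexPlane ∨ X = puncturedPlane ∨ X = disc))) :=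
  AbsTopIII.cor_4_5_joint_arch_of_full cor_4_5_full_geometric_carriers

/-- **`Cor_4_5_joint` OUTRIGHT over ALL finite étale covers of the thrice-punctured sphere `ℙ¹ ∖ {0, 1, ∞}`.**
[cite: MochizukiAbsTopIII2015, Corollary 4.5 pp.107–109] -/
theorem cor_4_5_joint_geometric_tripodCovers :
    AbsTopIII.Cor_4_5_joint
      (archLogFrobeniusData (geometricAutHolFieldFunctor (fun Y : HolRS =>
        Nonempty (Y ⟶ planeComplFinite ({0, 1} : Set ℂ) (Set.toFinite _)))))
      (archTelecoreData (geometricAutHolFieldFunctor (fun Y : HolRS =>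
        Nonempty (Y ⟶ planeComplFinite ({0, 1} : Set ℂ) (Set.toFinite _))))) :=
  AbsTopIII.cor_4_5_joint_arch_of_full cor_4_5_full_geometric_tripodCovers

/-- **`Cor_4_5_joint` OUTRIGHT over ALL finite étale covers of `ℂ ∖ F`, every finite `F` with two distinct
points.** [cite: MochizukiAbsTopIII2015, Corollary 4.5 pp.107–109] -/
theorem cor_4_5_joint_geometric_planeComplCovers {F : Set ℂ} (hF : F.Finite) {p₁ p₂ : ℂ}
    (hp₁ : p₁ ∈ F) (hp₂ : p₂ ∈ F) (hp : p₁ ≠ p₂) :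
    AbsTopIII.Cor_4_5_joint
      (archLogFrobeniusData (geometricAutHolFieldFunctor (fun Y : HolRS =>
        Nonempty (Y ⟶ planeComplFinite F hF))))
      (archTelecoreData (geometricAutHolFieldFunctor (fun Y : HolRS =>
        Nonempty (Y ⟶ planeComplFinite F hF)))) :=
  AbsTopIII.cor_4_5_joint_arch_of_full (cor_4_5_full_geometric_planeComplCovers hF hp₁ hp₂ hp)

/-- **`Cor_4_5_joint` OUTRIGHT over ALL finite étale covers of a punctured complex torus `ℂ/Φ(ℤ²) ∖ {x₀}`.**
[cite: MochizukiAbsTopIII2015, Corollary 4.5 pp.107–109] -/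
theorem cor_4_5_joint_geometric_puncturedTorusCovers (Φ : (Fin 2 → ℝ) ≃L[ℝ] ℂ)
    (x₀ : ComplexTorus Φ) :
    AbsTopIII.Cor_4_5_joint
      (archLogFrobeniusData (geometricAutHolFieldFunctor (fun Y : HolRS =>
        Nonempty (Y ⟶ puncturedTorus Φ x₀))))
      (archTelecoreData (geometricAutHolFieldFunctor (fun Y : HolRS =>
        Nonempty (Y ⟶ puncturedTorus Φ x₀)))) :=
  AbsTopIII.cor_4_5_joint_arch_of_full (cor_4_5_full_geometric_puncturedTorusCovers Φ x₀)

/-- **`Cor_4_5_joint` OUTRIGHT over ALL finite étale covers of a once-punctured elliptic curve.**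
[cite: MochizukiAbsTopIII2015, Corollary 4.5 pp.107–109] -/
theorem cor_4_5_joint_geometric_mapsTo_of_isPuncturedEllipticCurve (X : HolRS)
    (hX : TorsionPointsDenseUniqueGroupLaw.IsPuncturedEllipticCurve X.carrier) :
    AbsTopIII.Cor_4_5_joint
      (archLogFrobeniusData (geometricAutHolFieldFunctor (fun Y : HolRS => Nonempty (Y ⟶ X))))
      (archTelecoreData (geometricAutHolFieldFunctor (fun Y : HolRS => Nonempty (Y ⟶ X)))) :=
  AbsTopIII.cor_4_5_joint_arch_of_full (cor_4_5_full_geometric_mapsTo_of_isPuncturedEllipticCurve X hX)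

/-- **`Cor_4_5_joint` OUTRIGHT over the compact hyperbolic uniformised base `X₀ = ℍ/Γ̄`, `Γ̄` an orientable
surface group** acting freely, properly discontinuously and cocompactly — structural data only.
[cite: MochizukiAbsTopIII2015, Corollary 4.5 pp.107–109] -/
theorem cor_4_5_joint_geometric_mapsTo_pslQuotient_of_isOrientableSurfaceGroup (Γ : Subgroup PSL2R)
    [ProperlyDiscontinuousSMul Γ ℍ] [IsCancelSMul Γ ℍ] [CompactSpace (orbitRel.Quotient Γ ℍ)]
    (hΓ : IsOrientableSurfaceGroup Γ) :
    AbsTopIII.Cor_4_5_joint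
      (archLogFrobeniusData (geometricAutHolFieldFunctor fun Y : HolRS => Nonempty (Y ⟶ pslQuotient Γ)))
      (archTelecoreData (geometricAutHolFieldFunctor fun Y : HolRS => Nonempty (Y ⟶ pslQuotient Γ))) :=
  AbsTopIII.cor_4_5_joint_arch_of_full
    (cor_4_5_full_geometric_mapsTo_pslQuotient_of_isOrientableSurfaceGroup Γ hΓ)

/-- **`Cor_4_5_joint` at a GENUINE compact Riemann surface holomorphically covered by `ℍ` with surface-group
`π₁` — NO residual hypothesis.** [cite: MochizukiAbsTopIII2015, Corollary 4.5 pp.107–109] -/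
theorem cor_4_5_joint_mapsTo_of_cover_of_isOrientableSurfaceGroup (X : HolRS) [CompactSpace X.carrier]
    {k : ℍ → X.carrier} (hk : IsCoveringMap k) (dk : MDifferentiable 𝓘(ℂ, ℂ) 𝓘(ℂ, ℂ) k) (x₀ : X.carrier)
    (hπ : IsOrientableSurfaceGroup (FundamentalGroup X.carrier x₀)) :
    AbsTopIII.Cor_4_5_joint
      (archLogFrobeniusData (geometricAutHolFieldFunctor fun Y : HolRS => Nonempty (Y ⟶ X)))
      (archTelecoreData (geometricAutHolFieldFunctor fun Y : HolRS => Nonempty (Y ⟶ X))) :=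
  AbsTopIII.cor_4_5_joint_arch_of_full
    (X.isIdRigid_EA_and_cor_4_5_full_mapsTo_of_cover_of_isOrientableSurfaceGroup hk dk x₀ hπ).2

end HolRS

end Literature.AnabelianGeometry.AbsoluteAnabelian
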